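import Literature.NumberTheory.EllipticCurves.Jetchev2008.HeegnerPointGlobalDivisibility
import Literature.NumberTheory.EllipticCurves.Jetchev2008.CoreVertices
import HarnessLib

/-!
# BSD rank-≤1 literature → partition programme, T1 JET (cell `bsd-jet`), bucket A (`q ≠ p`): the
# READING binder `JetchevDivisibilityCarrierNe` — Jetchev 2008 Thm. 1.4 (`m_∞ ≥ ord_p c_q`) at a
# Tamagawa carrier `q ≠ p`, with NO hypothesis on the reduction of `E` at `p`

HONEST FRAMING (programme file `BSD-LIT2PART-PROGRAMME-v1.md` §HONESTY, verbatim): «no tranche here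
proves BSD; ARM L moves the LITERAL column of an r ≤ 1 census into the kernel-proved-modulo-named-print
column; ARM P changes what «named print» is worth.» This file (seat `bsd-jet-pv-1`, prover; cell HOME
`run/shared/lean/pub/bsd-jet/`) declares ONE `Prop` and proves nothing. The `Prop` is NOT a published
theorem and is NOT a Literature fact: it is the cell's READING of a printed proof, typed BY NAME so
that the referee's D-audit (sheet `HOME/sheets/PV1-A-BLOCK-READING.md`, readers' sheets
`D-AUDIT-JET-read-1/2`) and the kernel consumers (`Rank1ResidualJetCarrierNe.lean`) speak about the
same object. Typed ≠ proved ≠ endorsed. Every consumer takes it as an explicit hypothesis `(hJ : …)`;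
the gate records such results as CONDITIONAL.

## What is printed, and what this binder changes

D. Jetchev, *Global divisibility of Heegner points and Tamagawa numbers*, Compos. Math. **144** (2008)
811–826 [held: `paper:arxiv-math_0703431`], p. 812: *"Hypothesis (∗): `p ∤ N` and … `ρ_{E,p}` is
surjective"*; *"**Theorem 1.4.** Assume that `p` satisfies Hypothesis (∗). If
`m_max = max_{q ∣ N} ord_p(c_q)`, then `m_∞ ≥ m_max`."* The tree's Literature fact
`Jetchev2008.thm14_derivedPoint_divisible_of_le_padicValNat_tamagawa` (`p455814`, seat
`bsd-jet-lit-ty`) is that theorem AS PRINTED, in McCallum's `M_∞` currency (global `p^s`-divisibility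
of every derived Heegner point `P_n` to every depth `s ≤ ord_p c_q`, for every prime `q ∣ N`).

`JetchevDivisibilityCarrierNe` below is the SAME statement with three changes, each a READING of the
printed PROOF (§§3–6 of the paper; audit `HOME/sheets/PV1-A-BLOCK-READING.md`, stepL's
`pub/bsd-stepL/tam3/MEMO-J3-v2.md` §2 at `p = 3`):
1. the hypothesis «`p ∤ N`» of (∗) is DROPPED and the carrier is restricted to `q ≠ p` (bucket A of
   the register flag `JET@p∣N`). Reading: in the printed proof of Thm. 1.4 (Thm. 6.3 + Prop. 6.4),
   «`p ∤ N`» is consumed only through Lemma 4.3 (*"Let `v ∤ p` … `E⁰(K_v^ur)` is `p`-divisible"*,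
   p0009) inside Prop. 4.9 at the places `v ∣ q` of the ONE stringent prime `q` of
   `𝓕₀ = 𝓕_⌈q⌉` (Thm. 6.3, p0015: *"differs from `𝓕` only at the two places `v` and `v̄` above `q`"*);
   for `q ≠ p` these places have residue characteristic `q ≠ p` and Lemma 4.3 applies verbatim. The
   Selmer conditions of `κ_{c,m}` at the other bad places (including `w ∣ p` when `p ∣ N`) are Gross
   1991 Prop. 6.2 (1), whose printed proof (LMS LN 153, p. 245: `H¹(K_v^un/K_v, E⁰) = 0`, [GZ III.3.1],
   `E(ℚ)_p = 0` ⇒ cocycle valued in `E′` with `(E′ : E⁰)` prime to `p`) has no `p`-versus-`N`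
   hypothesis; Kolyvagin's formula / `M_r` framework is McCallum 1991 (same volume), also without one.
2. the image hypothesis is the `p`-ADIC TOWER `ρ̄_{E,p^n}` onto for every `n` (STRONGER than the
   printed mod-`p` surjectivity, hence a WEAKER binder) — the choice of the structure-theorem facts
   `McCallum1991_…` of the tree (flag `McCallum91-padic-image`), through which Jetchev's Lemma 6.1
   (Čebotarev, *"follows immediately from [McCallum]"*) is read; for `p ≥ 5` it follows from mod-`p`
   surjectivity (Serre; tree theorem `serre_hasSurjectiveModNGaloisRep_pow_holds`).
3. OPTIMALITY of the parametrisation is not recorded (the Literature fact records it as `∃ Dt₀, …`):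
   the printed proof of Thm. 1.4 never uses the optimality of `φ` (it enters Conj. 1.1 ∕ Rem. 1.2 via
   the Manin constant only); Cor. 3.2 (*"`y_c` lies, up to translation by a rational torsion point of
   `E`, on `E⁰(K[c]_w)`"*) holds for every modular parametrisation `X₀(N) → J₀(N) → E` by Néron
   functoriality, and the structure-theorem facts of the tree are likewise stated for an arbitrary
   frame `(Dt, β, ι)`.
Unchanged from the Literature fact: `W/ℚ` globally minimal, non-CM; `K` imaginary quadratic with the
Heegner hypothesis for `N = W.conductorNorm ℤ`, `d_K ∉ {−3, −4}`; `p ≠ 2`; a conductor-`1` datum `d₁`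
with `P_1 = y_K` of infinite order; `c_q = (W.baseChange ℚ_[q]).localTamagawaNumber ℤ_[q]`; Kolyvagin
primes and indices `Zhang2014.IsKolyvaginPrime` ∕ `Zhang2014.kolyvaginIndex`; conclusion = `p^s`-
divisibility of `d.derivedPoint` in `E(K[n])` for every `s ≤ ord_p c_q`.

STATUS OF THE STATEMENT: for `p ∤ N` it is implied by the printed Thm. 1.4 up to items 2–3; for
`p ∣ N`, `q ≠ p` it is the cell's reading «the printed argument goes through verbatim» (referee C2 ∕ A
to rule on the D-audit sheets); it is finitely falsifiable per pair (one derived point `P_n`,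
`n ∈ Λ_s`, `s ≤ ord_p c_q`, not `p^s`-divisible refutes it at that pair). Bucket B (`q = p`) is NOT
this binder (seat `bsd-jet-pv-2`).

References: [Jetchev2008] Hypothesis (∗), Thm. 1.4, Cor. 1.5 (p. 812), §3.1, Prop. 3.1 ∕ Cor. 3.2,
Lemma 4.3, Prop. 4.9, Thm. 5.1, Lemma 5.2, Lemma 6.1 ∕ Rem. 6.2, Thm. 6.3, Prop. 6.4; [GrossLMS1991]
Prop. 6.2 (p. 245), §4 (4.1); [McCallumLMS1991] §4 Prop. 4.7 (p. 300), §5 Lemma 5.1, Thm. 5.4,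
Cor. 5.6; [MilneADT2006] I Prop. 3.8.
-/

noncomputable section

open scoped Classical

open WeierstrassCurve Literature.NumberTheory.EllipticCurves
  Literature.NumberTheory.EllipticCurves.ModularForms

namespace Summit.BirchSwinnertonDyer.Rank1Residual.JET

/-- **READING binder (bucket A of `JET@p∣N`): Jetchev 2008 Thm. 1.4 `m_∞ ≥ ord_p c_q` at a Tamagawa
carrier `q ≠ p`, no hypothesis on the reduction of `E` at `p`.** NOT a published statement (Jetchev
prints it under Hypothesis (∗) ∋ «`p ∤ N`», Compos. Math. 144 (2008) p. 812); it is the body of the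
Literature fact `Jetchev2008.thm14_derivedPoint_divisible_of_le_padicValNat_tamagawa` with «`p ∤ N`»
dropped, the carrier restricted to `q ≠ p`, the `p`-adic tower image hypothesis, and an arbitrary
frame (see the module docstring, items 1–3, for why each change is a reading of the printed proof).
For `W/ℚ` globally minimal non-CM, `K` imaginary quadratic Heegner for `N = W.conductorNorm ℤ` with
`d_K ∉ {−3, −4}`, `p ≠ 2` with `ρ̄_{E,p^n}` onto for all `n`, a frame `(Dt, β, ι)` with a conductor-`1`
datum `d₁` whose derived point `P_1 = y_K` has infinite order, a prime `q ∣ N` with `q ≠ p`: every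
derived Heegner point `P_n = d.derivedPoint` of square-free conductor `n` (all prime factors Kolyvagin
primes of index `≥ s`) is `p^s`-divisible in `E(K[n])` for every `s ≤ ord_p c_q(E)`. Consumers take
`(hJ : JetchevDivisibilityCarrierNe)`; nothing is asserted.
[cite: Jetchev2008, Thm. 1.4 and Hypothesis (*) (p. 812); Lemma 4.3, Prop. 4.9, Thm. 6.3]
[cite: GrossLMS1991, Prop. 6.2 (1) (p. 245)] [cite: McCallumLMS1991, §5 Lemma 5.1 and Cor. 5.6] -/
@[conjecture] def JetchevDivisibilityCarrierNe : Prop :=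
  ∀ (W : WeierstrassCurve ℚ) [W.IsElliptic] [W.IsGloballyMinimal] [NeZero (W.conductorNorm ℤ)],
    ¬ W.HasCM →
    ∀ (K : Type) [Field K] [NumberField K], IsImaginaryQuadratic K →
    NumberField.discr K ≠ -3 → NumberField.discr K ≠ -4 →
    SatisfiesHeegnerHypothesis (W.conductorNorm ℤ) K →
    ∀ (p : ℕ) [Fact p.Prime], p ≠ 2 → (∀ n : ℕ, W.HasSurjectiveModNGaloisRep (p ^ n : ℕ)) →
    ∀ (Dt : ModularParametrizationData W (W.conductorNorm ℤ)) (β : ℤ) (ι : K →+* ℂ)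
      (d₁ : KolyvaginHeegnerData Dt β ι 1), ¬ IsOfFinAddOrder d₁.derivedPoint →
    ∀ (q : ℕ) [Fact q.Prime], q ∣ W.conductorNorm ℤ → q ≠ p →
    ∀ (s : ℕ), s ≤ padicValNat p ((W.baseChange ℚ_[q]).localTamagawaNumber ℤ_[q]) →
    ∀ (n : ℕ) (d : KolyvaginHeegnerData Dt β ι n), Squarefree n →
      (∀ ℓ ∈ n.primeFactors, Zhang2014.IsKolyvaginPrime (W.conductorNorm ℤ) W K p ℓ ∧
        s ≤ Zhang2014.kolyvaginIndex W p ℓ) →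
      ∃ Q : (W.baseChange (ringClassField K ι n)).toAffine.Point,
        ((p ^ s : ℕ) : ℤ) • Q = d.derivedPoint

/-- **The printed theorem implies the reading binder off `N`**: at a prime `p ∤ N` (so `q ≠ p` is
automatic and vacuous as a restriction) Jetchev's Thm. 1.4 AS PRINTED
(`Jetchev2008.thm14_derivedPoint_divisible_of_le_padicValNat_tamagawa`), read with the `p`-adic tower
(which gives mod-`p` surjectivity at `n = 1`) and granted the optimality datum of the curve, yields the
conclusion of `JetchevDivisibilityCarrierNe` — bookkeeping showing the binder is a conservative
rephrasing where print applies. [cite: Jetchev2008, Thm. 1.4 (p. 812)] -/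
theorem jetchevDivisibilityCarrierNe_conclusion_of_thm14_of_not_dvd
    (hJ14 : Jetchev2008.thm14_derivedPoint_divisible_of_le_padicValNat_tamagawa)
    (W : WeierstrassCurve ℚ) [W.IsElliptic] [W.IsGloballyMinimal] [NeZero (W.conductorNorm ℤ)]
    (hcm : ¬ W.HasCM) (K : Type) [Field K] [NumberField K] (hK : IsImaginaryQuadratic K)
    (hD3 : NumberField.discr K ≠ -3) (hD4 : NumberField.discr K ≠ -4)
    (hH : SatisfiesHeegnerHypothesis (W.conductorNorm ℤ) K)
    (p : ℕ) [Fact p.Prime] (hp2 : p ≠ 2) (hpN : ¬ p ∣ W.conductorNorm ℤ)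
    (htower : ∀ n : ℕ, W.HasSurjectiveModNGaloisRep (p ^ n : ℕ))
    (hopt : ∃ Dt₀ : ModularParametrizationData W (W.conductorNorm ℤ),
      ∀ z ∈ Dt₀.L.lattice, ∃ w ∈ periodLattice Dt₀.f, z = (Dt₀.c : ℂ) * w)
    (Dt : ModularParametrizationData W (W.conductorNorm ℤ)) (β : ℤ) (ι : K →+* ℂ)
    (d₁ : KolyvaginHeegnerData Dt β ι 1) (hy : ¬ IsOfFinAddOrder d₁.derivedPoint)
    (q : ℕ) [Fact q.Prime] (hq : q ∣ W.conductorNorm ℤ)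
    (s : ℕ) (hs : s ≤ padicValNat p ((W.baseChange ℚ_[q]).localTamagawaNumber ℤ_[q]))
    (n : ℕ) (d : KolyvaginHeegnerData Dt β ι n) (hn : Squarefree n)
    (hℓ : ∀ ℓ ∈ n.primeFactors, Zhang2014.IsKolyvaginPrime (W.conductorNorm ℤ) W K p ℓ ∧
      s ≤ Zhang2014.kolyvaginIndex W p ℓ) :
    ∃ Q : (W.baseChange (ringClassField K ι n)).toAffine.Point,
      ((p ^ s : ℕ) : ℤ) • Q = d.derivedPoint := by
  have hsurj : W.HasSurjectiveModNGaloisRep (p : ℤ) := by simpa using htower 1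
  exact hJ14 W hcm K hK hD3 hD4 hH p hp2 hpN hsurj hopt Dt β ι d₁ hy q hq s hs n d hn hℓ

/-! ### Bucket B (`q = p`): the carrier is the multiplicative prime itself (seat `bsd-jet-pv-2`) -/

/-- **READING binder (bucket B of `JET@p∣N`): Jetchev 2008 Thm. 1.4 `m_∞ ≥ ord_p c_p` when the
Tamagawa carrier is the prime `p` itself, `p` of MULTIPLICATIVE reduction** (`p ∥ N`; on the register:
split `I_n` at `p` with `p ∣ n = c_p` — 72 249 classes, `HOME/census-jet/jet_keys_B_classes.tsv`).
The twin of `JetchevDivisibilityCarrierNe` with the carrier clause «`q ∣ N`, `q ≠ p`» replaced by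
«`W.HasMultiplicativeReductionAtPrime p`, carrier `p`» (same image hypothesis — the `p`-adic tower,
a THEOREM at a multiplicative odd `p` from mod-`p` surjectivity,
`WeierstrassCurve.forall_hasSurjectiveModNGaloisRep_pow_of_multiplicative_of_surj` —, same frame,
no optimality). NOT a published statement. Reading of the printed proof (audit sheet
`HOME/sheets/PV2-B-GAP.md`): exactly ONE printed step fails at `q = p` — Prop. 4.9 at the stringent
places `v ∣ p` invokes Lemma 4.3 (*"Let `v ∤ p` … `E⁰(K_v^ur)` is `p`-divisible"*, p0009), whose
conclusion is FALSE at a multiplicative place above `p`; that step is REPLACED by the tree theorem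
`X11b.Three.JetchevKummer.localKummerMap_mem_connectedKummerCondition_padic_of_cocycle`
(`X11b/Three/MultiplicativePlaceAlpha.lean`: Gross's component-group argument, `H¹(Gal(L/ℚ_p), E₀(L)) = 0`
and `hstab` discharged) modulo [GZ86, III (3.1)] — which the printed proof uses at the same line
(Cor. 3.2) — and the x11b3 layer binders R1–R8; every other step is carrier-blind (as for bucket A).
For `W/ℚ` globally minimal non-CM, `K` imaginary quadratic Heegner for `N = W.conductorNorm ℤ` with
`d_K ∉ {−3, −4}`, `p ≠ 2` multiplicative with `ρ̄_{E,p^n}` onto for all `n`, a frame `(Dt, β, ι)` with a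
conductor-`1` datum `d₁` whose derived point `P_1 = y_K` has infinite order: every derived Heegner
point `P_n = d.derivedPoint` (square-free `n`, all prime factors Kolyvagin primes of index `≥ s`) is
`p^s`-divisible in `E(K[n])` for every `s ≤ ord_p c_p(E)`. Consumers (`Rank1ResidualJetCarrierMult.lean`)
take `(hJ : JetchevDivisibilityCarrierMult)`; nothing is asserted. At `Ш`-level (Cor. 1.5, `q = p`,
any `p ∣ N`) the typed twin is `AdditiveThree.JetchevBoundAtP` (`Additive/WildThreeJetchevAtThree.lean`).
[cite: Jetchev2008, Thm. 1.4 and Hypothesis (*) (p. 812); Lemma 4.3, Prop. 4.9, Thm. 6.3]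
[cite: GrossLMS1991, Prop. 6.2 (1) (p. 245)] [cite: McCallumLMS1991, §5 Lemma 5.1 and Cor. 5.6]
[cite: Wuthrich2014, Lemma 20 (p. 399)] -/
@[conjecture] def JetchevDivisibilityCarrierMult : Prop :=
  ∀ (W : WeierstrassCurve ℚ) [W.IsElliptic] [W.IsGloballyMinimal] [NeZero (W.conductorNorm ℤ)],
    ¬ W.HasCM →
    ∀ (K : Type) [Field K] [NumberField K], IsImaginaryQuadratic K →
    NumberField.discr K ≠ -3 → NumberField.discr K ≠ -4 →
    SatisfiesHeegnerHypothesis (W.conductorNorm ℤ) K →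
    ∀ (p : ℕ) [Fact p.Prime], p ≠ 2 → W.HasMultiplicativeReductionAtPrime p →
      (∀ n : ℕ, W.HasSurjectiveModNGaloisRep (p ^ n : ℕ)) →
    ∀ (Dt : ModularParametrizationData W (W.conductorNorm ℤ)) (β : ℤ) (ι : K →+* ℂ)
      (d₁ : KolyvaginHeegnerData Dt β ι 1), ¬ IsOfFinAddOrder d₁.derivedPoint →
    ∀ (s : ℕ), s ≤ padicValNat p ((W.baseChange ℚ_[p]).localTamagawaNumber ℤ_[p]) →
    ∀ (n : ℕ) (d : KolyvaginHeegnerData Dt β ι n), Squarefree n →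
      (∀ ℓ ∈ n.primeFactors, Zhang2014.IsKolyvaginPrime (W.conductorNorm ℤ) W K p ℓ ∧
        s ≤ Zhang2014.kolyvaginIndex W p ℓ) →
      ∃ Q : (W.baseChange (ringClassField K ι n)).toAffine.Point,
        ((p ^ s : ℕ) : ℤ) • Q = d.derivedPoint

/-- **Buckets A and B together = Thm. 1.4 read at a multiplicative `p ∥ N` for EVERY carrier `q ∣ N`**
(the single reading statement (J∥) of the cell's sheets, in the two binders' common currency): given
`JetchevDivisibilityCarrierNe` (carriers `q ≠ p`) and `JetchevDivisibilityCarrierMult` (carrier `p`),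
for `W` multiplicative at `p` with the `p`-adic tower, every derived Heegner point on a frame whose
`y_K` has infinite order is `p^s`-divisible for every `s ≤ ord_p c_q(E)` and every prime `q ∣ N` —
by cases `q = p` ∕ `q ≠ p`. Bookkeeping; CONDITIONAL on both binders. [cite: Jetchev2008, Thm. 1.4 (p. 812)] -/
theorem jetchevDivisibility_of_carrierNe_of_carrierMult
    (hA : JetchevDivisibilityCarrierNe) (hB : JetchevDivisibilityCarrierMult)
    (W : WeierstrassCurve ℚ) [W.IsElliptic] [W.IsGloballyMinimal] [NeZero (W.conductorNorm ℤ)]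
    (hcm : ¬ W.HasCM) (K : Type) [Field K] [NumberField K] (hK : IsImaginaryQuadratic K)
    (hD3 : NumberField.discr K ≠ -3) (hD4 : NumberField.discr K ≠ -4)
    (hH : SatisfiesHeegnerHypothesis (W.conductorNorm ℤ) K)
    (p : ℕ) [Fact p.Prime] (hp2 : p ≠ 2) (hmult : W.HasMultiplicativeReductionAtPrime p)
    (htower : ∀ n : ℕ, W.HasSurjectiveModNGaloisRep (p ^ n : ℕ))
    (Dt : ModularParametrizationData W (W.conductorNorm ℤ)) (β : ℤ) (ι : K →+* ℂ)
    (d₁ : KolyvaginHeegnerData Dt β ι 1) (hy : ¬ IsOfFinAddOrder d₁.derivedPoint)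
    (q : ℕ) [Fact q.Prime] (hq : q ∣ W.conductorNorm ℤ)
    (s : ℕ) (hs : s ≤ padicValNat p ((W.baseChange ℚ_[q]).localTamagawaNumber ℤ_[q]))
    (n : ℕ) (d : KolyvaginHeegnerData Dt β ι n) (hn : Squarefree n)
    (hℓ : ∀ ℓ ∈ n.primeFactors, Zhang2014.IsKolyvaginPrime (W.conductorNorm ℤ) W K p ℓ ∧
      s ≤ Zhang2014.kolyvaginIndex W p ℓ) :
    ∃ Q : (W.baseChange (ringClassField K ι n)).toAffine.Point,
      ((p ^ s : ℕ) : ℤ) • Q = d.derivedPoint := by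
  by_cases hqp : q = p
  · subst hqp
    exact hB W hcm K hK hD3 hD4 hH q hp2 hmult htower Dt β ι d₁ hy s hs n d hn hℓ
  · exact hA W hcm K hK hD3 hD4 hH p hp2 htower Dt β ι d₁ hy q hq hqp s hs n d hn hℓ

/-! ### Bucket B-add (`q = p = 3`, ADDITIVE carrier): Kodaira IV / IV* at `3`, `c₃ = 3` (seat `bsd-jet-pv-2`) -/

/-- **READING binder (bucket B-add of `JET@p∣N`): Jetchev 2008 Thm. 1.4 `m_∞ ≥ ord_p c_p` when the
Tamagawa carrier is the prime `p` itself and `E` has ADDITIVE reduction at `p`.** On the register this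
is `p = 3`, Kodaira IV (7 753 cells) or IV* (11 471 cells) at `3` with `c₃ = 3` — 19 224 of the 73 456
bucket-B cells (`HOME/census-jet/jet_keys_B_classes.tsv`, columns `bucket = B`, `red_p = additive`); an
odd `p` divides the Tamagawa number of an additive fibre only for `p = 3` at IV/IV* (Tate's algorithm),
so no other prime occurs. The twin of `JetchevDivisibilityCarrierMult` with «`W.HasMultiplicativeReductionAtPrime p`»
replaced by «`¬ W.HasGoodReductionAtPrime p ∧ ¬ W.HasMultiplicativeReductionAtPrime p`» (additive at
`p`, the cell predicate `Rank1Residual.Addv W p` unfolded); same `p`-adic tower image hypothesis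
(at an additive `3` the tower does NOT follow from mod-`3` surjectivity — Elkies 2006 —; rows supply it
by the mod-`9` Frobenius certificate `WeierstrassCurve.forall_hasSurjectiveModNGaloisRep_three_pow_of_frobenius`),
same frame, no optimality. NOT a published statement. Reading of the printed proof: as for the other
two buckets, «`p ∤ N`» enters only through Lemma 4.3 inside Prop. 4.9 at the stringent places `v ∣ p`,
and Lemma 4.3's conclusion (`E⁰(K_v^ur)` `p`-divisible) is FALSE at an additive place above `p`
(`Ẽ_ns = 𝔾_a` is `p`-torsion); that step is REPLACED by the x11b3 tree theorem
`X11b.Three.JetchevKummer.localKummerMap_mem_connectedKummerCondition_of_cocycle_of_hasAdditiveReduction`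
(`X11b/Three/AdditivePlaceKummer.lean`; single entry for every bad place:
`…_padic_of_cocycle_of_not_hasGoodReductionAtPrime`, `X11b/Three/BadPlaceKummer.lean`) modulo
[GZ86, III (3.1)] and the layer binders R1–R6, R8 of `S15-INTERFACE.md` §4; the local quotient of
Thm. 6.3 at `v ∣ 3` is `E(K_v)/(E⁰(K_v) + 3^m E(K_v)) ≅ Φ_v(𝔽₃) ≅ ℤ/3` (IV, IV*: `Φ = ℤ/3`, cyclic);
every other step is carrier-blind (kernel: `JET.Section6.tamagawaExponent_le_mInfty_of_minimalCoreVertex`,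
`Rank1ResidualJetSection6.lean`). For `W/ℚ` globally minimal non-CM, `K` imaginary quadratic Heegner for
`N = W.conductorNorm ℤ` with `d_K ∉ {−3, −4}`, `p ≠ 2` additive with `ρ̄_{E,p^n}` onto for all `n`, a
frame `(Dt, β, ι)` with a conductor-`1` datum `d₁` whose derived point `P_1 = y_K` has infinite order:
every derived Heegner point `P_n = d.derivedPoint` (square-free `n`, all prime factors Kolyvagin primes
of index `≥ s`) is `p^s`-divisible in `E(K[n])` for every `s ≤ ord_p c_p(E)`. Consumers
(`Rank1ResidualJetCarrierAdd.lean`) take `(hJ : JetchevDivisibilityCarrierAdd)`; nothing is asserted.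
At `Ш`-level and with the mod-`p` image only, the per-curve typed twin is `AdditiveThree.JetchevBoundAtP`
(`Additive/WildThreeJetchevAtThree.lean`, cell O6).
[cite: Jetchev2008, Thm. 1.4 and Hypothesis (*) (p. 812); Lemma 4.3, Prop. 4.9, Thm. 6.3]
[cite: GrossLMS1991, Prop. 6.2 (1) (p. 245)] [cite: McCallumLMS1991, §5 Lemma 5.1 and Cor. 5.6]
[cite: Elkies2006, Introduction (p. 1)] -/
@[conjecture] def JetchevDivisibilityCarrierAdd : Prop :=
  ∀ (W : WeierstrassCurve ℚ) [W.IsElliptic] [W.IsGloballyMinimal] [NeZero (W.conductorNorm ℤ)],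
    ¬ W.HasCM →
    ∀ (K : Type) [Field K] [NumberField K], IsImaginaryQuadratic K →
    NumberField.discr K ≠ -3 → NumberField.discr K ≠ -4 →
    SatisfiesHeegnerHypothesis (W.conductorNorm ℤ) K →
    ∀ (p : ℕ) [Fact p.Prime], p ≠ 2 →
      ¬ W.HasGoodReductionAtPrime p → ¬ W.HasMultiplicativeReductionAtPrime p →
      (∀ n : ℕ, W.HasSurjectiveModNGaloisRep (p ^ n : ℕ)) →
    ∀ (Dt : ModularParametrizationData W (W.conductorNorm ℤ)) (β : ℤ) (ι : K →+* ℂ)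
      (d₁ : KolyvaginHeegnerData Dt β ι 1), ¬ IsOfFinAddOrder d₁.derivedPoint →
    ∀ (s : ℕ), s ≤ padicValNat p ((W.baseChange ℚ_[p]).localTamagawaNumber ℤ_[p]) →
    ∀ (n : ℕ) (d : KolyvaginHeegnerData Dt β ι n), Squarefree n →
      (∀ ℓ ∈ n.primeFactors, Zhang2014.IsKolyvaginPrime (W.conductorNorm ℤ) W K p ℓ ∧
        s ≤ Zhang2014.kolyvaginIndex W p ℓ) →
      ∃ Q : (W.baseChange (ringClassField K ι n)).toAffine.Point,
        ((p ^ s : ℕ) : ℤ) • Q = d.derivedPoint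

/-- **All three buckets together = Thm. 1.4 read at ANY bad `p ∣ N` for EVERY carrier `q ∣ N`**
(the reading statement (J∣N) in the three binders' common currency): given
`JetchevDivisibilityCarrierNe` (carriers `q ≠ p`), `JetchevDivisibilityCarrierMult` (carrier `p`
multiplicative) and `JetchevDivisibilityCarrierAdd` (carrier `p` additive), for `W` with BAD reduction
at `p` (`¬ W.HasGoodReductionAtPrime p`) and the `p`-adic tower, every derived Heegner point on a frame
whose `y_K` has infinite order is `p^s`-divisible for every `s ≤ ord_p c_q(E)` and every prime `q ∣ N`
— by cases `q ≠ p` ∕ `q = p` multiplicative ∕ `q = p` additive. Bookkeeping; CONDITIONAL on the three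
binders. [cite: Jetchev2008, Thm. 1.4 (p. 812)] -/
theorem jetchevDivisibility_of_carrierNe_of_carrierMult_of_carrierAdd
    (hA : JetchevDivisibilityCarrierNe) (hB : JetchevDivisibilityCarrierMult)
    (hC : JetchevDivisibilityCarrierAdd)
    (W : WeierstrassCurve ℚ) [W.IsElliptic] [W.IsGloballyMinimal] [NeZero (W.conductorNorm ℤ)]
    (hcm : ¬ W.HasCM) (K : Type) [Field K] [NumberField K] (hK : IsImaginaryQuadratic K)
    (hD3 : NumberField.discr K ≠ -3) (hD4 : NumberField.discr K ≠ -4)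
    (hH : SatisfiesHeegnerHypothesis (W.conductorNorm ℤ) K)
    (p : ℕ) [Fact p.Prime] (hp2 : p ≠ 2) (hbad : ¬ W.HasGoodReductionAtPrime p)
    (htower : ∀ n : ℕ, W.HasSurjectiveModNGaloisRep (p ^ n : ℕ))
    (Dt : ModularParametrizationData W (W.conductorNorm ℤ)) (β : ℤ) (ι : K →+* ℂ)
    (d₁ : KolyvaginHeegnerData Dt β ι 1) (hy : ¬ IsOfFinAddOrder d₁.derivedPoint)
    (q : ℕ) [Fact q.Prime] (hq : q ∣ W.conductorNorm ℤ)
    (s : ℕ) (hs : s ≤ padicValNat p ((W.baseChange ℚ_[q]).localTamagawaNumber ℤ_[q]))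
    (n : ℕ) (d : KolyvaginHeegnerData Dt β ι n) (hn : Squarefree n)
    (hℓ : ∀ ℓ ∈ n.primeFactors, Zhang2014.IsKolyvaginPrime (W.conductorNorm ℤ) W K p ℓ ∧
      s ≤ Zhang2014.kolyvaginIndex W p ℓ) :
    ∃ Q : (W.baseChange (ringClassField K ι n)).toAffine.Point,
      ((p ^ s : ℕ) : ℤ) • Q = d.derivedPoint := by
  by_cases hqp : q = p
  · subst hqp
    by_cases hmult : W.HasMultiplicativeReductionAtPrime q
    · exact hB W hcm K hK hD3 hD4 hH q hp2 hmult htower Dt β ι d₁ hy s hs n d hn hℓ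
    · exact hC W hcm K hK hD3 hD4 hH q hp2 hbad hmult htower Dt β ι d₁ hy s hs n d hn hℓ
  · exact hA W hcm K hK hD3 hD4 hH p hp2 htower Dt β ι d₁ hy q hq hqp s hs n d hn hℓ


/-- **READING binder K5 (road K, all buckets of `JET@p∣N`): Jetchev 2008 Prop. 5.3 (= arXiv
Prop. 6.4, «existence of core vertices») READ AT A PRIME `p ∣ N`.** NOT a published statement: print
proves Prop. 5.3 under Hypothesis (∗) ∋ «`p ∤ N`» (Compos. Math. 144 (2008), p. 812), and the
Literature fact `Jetchev2008.prop53_exists_coreVertex_of_depth_add_le_levelIndex`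
(`Jetchev2008/CoreVertices.lean`, seat `bsd-jet-lit-ty`) carries that hypothesis verbatim. This
`Prop` is that fact's body with «`¬ p ∣ N`» DROPPED and the mod-`p` image hypothesis replaced by the
`p`-adic tower (the common prefix of `JetchevDivisibilityCarrierNe/Mult/Add`); everything else —
`τ ≠ 1`, the ring class fields as number fields (instance binder), the frame, `y_K` of infinite order,
`1 ≤ m`, the conductor `c ∈ Λ` with a datum of exact depth `s` and `s + m ≤ M(c)`, the conclusion
`∃ c' ∈ Λ_{m+s}` core vertex (`Jetchev2008.IsGlobalCoreVertex`) with `m(c') ≤ m(c)` — is byte-for-byte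
the typed fact. WHY A READING IS DEFENSIBLE (the cell's D-audit, for referee C ∕ A to rule): the
printed proof of Prop. 5.3 (pp. 823–824) uses only the self-dual Kummer structure `𝓕`, Lemma 5.1
(Čebotarev, [McC91] Cor. 3.2 — image hypothesis only), the lozenge Lemma 3.4, the comparison
Prop. 4.4 and `H⁰ = 0`; no local condition at a place of bad reduction and no `p`-versus-`N` input
occurs (sheets `HOME/sheets/PV1-A-BLOCK-READING.md` §2 row 9, `PV2-J6-KERNEL.md` §3 (iv)). ROLE: the
hypothesis `h64` of `JET.derivedPoint_divisible_of_prop52_of_section6` (`Rank1ResidualJetSection6Bridge.lean`)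
with `Core k c := Jetchev2008.IsGlobalCoreVertex W K ι τ p k c`; with it the three binders K1 ∕ K3 ∕ K4
reduce to McCallum Prop. 5.2 (typed), K5, and the KERNEL instantiation of the abstract Thm. 5.2
(= arXiv Thm. 6.3, `JET.Section6.tamagawaExponent_le_mInfty_of_minimalCoreVertex`). Consumers take
`(hCV : JetchevCoreVertexExistence)`; nothing is asserted; finitely falsifiable per datum.
[cite: Jetchev2008, Prop. 5.3 (p. 823) and its proof (pp. 823–824); Hypothesis (*) (p. 812); §5.2 (p. 821)]
[cite: McCallumLMS1991, §3 Cor. 3.2, §4 Prop. 4.4] -/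
@[conjecture] def JetchevCoreVertexExistence : Prop :=
  ∀ (W : WeierstrassCurve ℚ) [W.IsElliptic] [W.IsGloballyMinimal] [NeZero (W.conductorNorm ℤ)],
    ¬ W.HasCM →
    ∀ (K : Type) [Field K] [NumberField K], IsImaginaryQuadratic K →
    NumberField.discr K ≠ -3 → NumberField.discr K ≠ -4 →
    SatisfiesHeegnerHypothesis (W.conductorNorm ℤ) K →
    ∀ (τ : K ≃ₐ[ℚ] K), τ ≠ 1 →
    ∀ (p : ℕ) [Fact p.Prime], p ≠ 2 → (∀ n : ℕ, W.HasSurjectiveModNGaloisRep (p ^ n : ℕ)) →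
    ∀ (Dt : ModularParametrizationData W (W.conductorNorm ℤ)) (β : ℤ) (ι : K →+* ℂ)
      [∀ k : ℕ, NumberField (ringClassField K ι k)]
      (d₁ : KolyvaginHeegnerData Dt β ι 1), ¬ IsOfFinAddOrder d₁.derivedPoint →
    ∀ (m : ℕ), 1 ≤ m →
    ∀ (c : ℕ) (d : KolyvaginHeegnerData Dt β ι c), Squarefree c →
      (∀ ℓ ∈ c.primeFactors, Zhang2014.IsKolyvaginPrime (W.conductorNorm ℤ) W K p ℓ) →
    ∀ (s : ℕ), ¬ IsOfFinAddOrder d.derivedPoint →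
      (∃ Q : (W.baseChange (ringClassField K ι c)).toAffine.Point,
        ((p ^ s : ℕ) : ℤ) • Q = d.derivedPoint) →
      (¬ ∃ Q : (W.baseChange (ringClassField K ι c)).toAffine.Point,
        ((p ^ (s + 1) : ℕ) : ℤ) • Q = d.derivedPoint) →
      ((s + m : ℕ) : ℕ∞) ≤ Zhang2014.levelIndex W p c →
      ∃ (c' : ℕ) (d' : KolyvaginHeegnerData Dt β ι c'), Squarefree c' ∧
        (∀ ℓ ∈ c'.primeFactors, Zhang2014.IsKolyvaginPrime (W.conductorNorm ℤ) W K p ℓ ∧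
          m + s ≤ Zhang2014.kolyvaginIndex W p ℓ) ∧
        Jetchev2008.IsGlobalCoreVertex W K ι τ p m c' ∧
        ¬ IsOfFinAddOrder d'.derivedPoint ∧
        ¬ ∃ Q : (W.baseChange (ringClassField K ι c')).toAffine.Point,
          ((p ^ (s + 1) : ℕ) : ℤ) • Q = d'.derivedPoint

/-- **The printed fact implies the reading binder K5 off `N`**: at a prime `p ∤ N`, Jetchev's
Prop. 5.3 AS PRINTED (`Jetchev2008.prop53_exists_coreVertex_of_depth_add_le_levelIndex`), read
with the `p`-adic tower (mod-`p` surjectivity at `n = 1`), yields the conclusion of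
`JetchevCoreVertexExistence` — bookkeeping showing the binder is a conservative rephrasing where
print applies. [cite: Jetchev2008, Prop. 5.3 (p. 823)] -/
theorem jetchevCoreVertexExistence_conclusion_of_prop53_of_not_dvd
    (h53 : Jetchev2008.prop53_exists_coreVertex_of_depth_add_le_levelIndex)
    (W : WeierstrassCurve ℚ) [W.IsElliptic] [W.IsGloballyMinimal] [NeZero (W.conductorNorm ℤ)]
    (hcm : ¬ W.HasCM) (K : Type) [Field K] [NumberField K] (hK : IsImaginaryQuadratic K)
    (hD3 : NumberField.discr K ≠ -3) (hD4 : NumberField.discr K ≠ -4)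
    (hH : SatisfiesHeegnerHypothesis (W.conductorNorm ℤ) K)
    (τ : K ≃ₐ[ℚ] K) (hτ : τ ≠ 1)
    (p : ℕ) [Fact p.Prime] (hp2 : p ≠ 2) (hpN : ¬ p ∣ W.conductorNorm ℤ)
    (htower : ∀ n : ℕ, W.HasSurjectiveModNGaloisRep (p ^ n : ℕ))
    (Dt : ModularParametrizationData W (W.conductorNorm ℤ)) (β : ℤ) (ι : K →+* ℂ)
    [∀ k : ℕ, NumberField (ringClassField K ι k)]
    (d₁ : KolyvaginHeegnerData Dt β ι 1) (hy : ¬ IsOfFinAddOrder d₁.derivedPoint)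
    (m : ℕ) (hm : 1 ≤ m) (c : ℕ) (d : KolyvaginHeegnerData Dt β ι c) (hc : Squarefree c)
    (hℓ : ∀ ℓ ∈ c.primeFactors, Zhang2014.IsKolyvaginPrime (W.conductorNorm ℤ) W K p ℓ)
    (s : ℕ) (hnt : ¬ IsOfFinAddOrder d.derivedPoint)
    (hdiv : ∃ Q : (W.baseChange (ringClassField K ι c)).toAffine.Point,
      ((p ^ s : ℕ) : ℤ) • Q = d.derivedPoint)
    (hndiv : ¬ ∃ Q : (W.baseChange (ringClassField K ι c)).toAffine.Point,
      ((p ^ (s + 1) : ℕ) : ℤ) • Q = d.derivedPoint)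
    (hsM : ((s + m : ℕ) : ℕ∞) ≤ Zhang2014.levelIndex W p c) :
    ∃ (c' : ℕ) (d' : KolyvaginHeegnerData Dt β ι c'), Squarefree c' ∧
      (∀ ℓ ∈ c'.primeFactors, Zhang2014.IsKolyvaginPrime (W.conductorNorm ℤ) W K p ℓ ∧
        m + s ≤ Zhang2014.kolyvaginIndex W p ℓ) ∧
      Jetchev2008.IsGlobalCoreVertex W K ι τ p m c' ∧
      ¬ IsOfFinAddOrder d'.derivedPoint ∧
      ¬ ∃ Q : (W.baseChange (ringClassField K ι c')).toAffine.Point,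
        ((p ^ (s + 1) : ℕ) : ℤ) • Q = d'.derivedPoint :=
  h53 W hcm K hK hD3 hD4 hH τ hτ p hp2 hpN (by simpa using htower 1) Dt β ι d₁ hy m hm c d hc hℓ s
    hnt hdiv hndiv hsM

end Summit.BirchSwinnertonDyer.Rank1Residual.JET

end
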